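import Summits.Ventures.PercRepro.S1CoreCapEightZeroSharp
import Summits.Ventures.PercRepro.S1CoreCapEightOneSharp
import Summits.Ventures.PercRepro.S1CoreCapEightMeetSharp
import Summits.Ventures.PercRepro.S1CoreCapEightDisSharp
import Summits.Ventures.PercRepro.S1CoreCapEightFourSharp
import Summits.Ventures.PercRepro.S1CoreCapEightThreeNon

/-!
# PercRepro — THE EXACT VALUE `Q*(8) = 23`: `FourCapSpec capPaper 8 23` (p1, gen 29)

The assembly of the EXACT instance `ν = 8` of the 4-circuit-cap spec, by the number `n_big` of lines of `≥ 4`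
points, every case at its own constant: `n_big = 0` (`sum_cap_le_twenty_three_of_no_big`, `23`), `1`
(`sum_cap_le_twenty_three_of_one_big`, `23`), `2` in a plane (`sum_cap_le_twenty_three_of_two_big_plane`, `23`,
tight) or not (`sum_cap_le_eighteen_of_two_big_noncoplanar`), `3` in a plane
(`sum_cap_le_twenty_two_of_three_big_plane`), `3` not in a plane with a meeting pair
(`sum_cap_le_twenty_three_of_three_big_meet`) or pairwise disjoint (`sum_cap_le_twenty_three_of_three_disjoint`),
`≥ 4` (`four_big_bound_sharp`, `23`; five big lines are impossible inside it). The value `23` is attained — two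
simple 4-point lines through a vertex in a 9-point plane with two fat hubs — and is the censuses' `Q*(8)`
(`proofs/P1-S4-CAPBRIDGE.md` §19 ADDENDUM 4), so `fourCapSpec_eight_exact : FourCapSpec capPaper 8 23` is the
exact instance: `Q*(ν) = 1, 4, 5, 8, 11, 16, 19, 23` for `ν = 1, …, 8` are all kernel theorems.
`proofs/P1-S4-CAPBRIDGE.md` §21. Axioms: standard.
-/

namespace PercRepro

namespace S1

namespace FourCap

namespace Eight

open Seven

variable {β : Type} [DecidableEq β]

section Exact

variable {w : β → ℕ} {ls : Finset (Finset β)}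
  (h1 : ∀ L ∈ ls, ∀ v ∈ L, w v = 1 ∨ w v = 2)
  (h2 : ∀ L ∈ ls, 3 ≤ L.card ∧ wsum w L ≤ 5)
  (h3 : ∀ L ∈ ls, ∀ L' ∈ ls, L ≠ L' → (L ∩ L').card ≤ 1)
  (h4 : ∀ l : List (Finset β), l.Nodup → (∀ L ∈ l, L ∈ ls) → wsum w (unionL l) ≤ 8 + lineRank l)
  (h5 : ∀ l : List (Finset β), l.Nodup → (∀ L ∈ l, L ∈ ls) → lineRank l ≤ 3 → (unionL l).card ≤ 9)
  (h6 : ∀ l : List (Finset β), l.Nodup → (∀ L ∈ l, L ∈ ls) → lineRank l ≤ 4 → (unionL l).card ≤ 20)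

include h1 h2 h3 h4 h5 in
/-- **Three big lines not in a plane: cap sum `≤ 23`** — a meeting pair (three placements of
`sum_cap_le_twenty_three_of_three_big_meet`) or pairwise disjoint (`sum_cap_le_twenty_three_of_three_disjoint`). -/
theorem sum_cap_le_twenty_three_of_three_big_nonplanar {L₁ L₂ L₃ : Finset β} (hL₁ : L₁ ∈ ls) (hL₂ : L₂ ∈ ls)
    (hL₃ : L₃ ∈ ls) (h12 : L₂ ≠ L₁) (h13 : L₃ ≠ L₁) (h23 : L₃ ≠ L₂) (c1 : 4 ≤ L₁.card) (c2 : 4 ≤ L₂.card)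
    (c3 : 4 ≤ L₃.card) (hrest : ∀ L ∈ ls, L ≠ L₁ → L ≠ L₂ → L ≠ L₃ → L.card = 3)
    (hr : 3 < lineRank [L₃, L₂, L₁]) : ∑ L ∈ ls, capPaper L.card (fat w L) ≤ 23 := by
  -- no plane contains the three
  have hnt : ∀ l : List (Finset β), l.Nodup → (∀ L ∈ l, L ∈ ls) → lineRank l ≤ 3 →
      L₁ ∈ l → L₂ ∈ l → L₃ ∈ l → False := by
    intro l hnd hls hrl hl₁ hl₂ hl₃
    obtain ⟨-, -, -, k2, k3, e21, e3⟩ := plane_of_three_big h3 hL₁ hL₂ hL₃ h12 h13 h23 c1 c2 c3 hl₁ hl₂ hl₃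
      (h5 l hnd hls hrl)
    have := lineRank_three_of_triangle (L₁ := L₁) (by omega) (by omega) (by omega) e21 e3
    omega
  have p21 := h3 L₂ hL₂ L₁ hL₁ h12
  have p31 := h3 L₃ hL₃ L₁ hL₁ h13
  have p32 := h3 L₃ hL₃ L₂ hL₂ h23
  by_cases m21 : (L₂ ∩ L₁).card = 1
  · exact sum_cap_le_twenty_three_of_three_big_meet h1 h2 h3 h4 h5 hL₁ hL₂ hL₃ h12 h13 h23 c1 c2 c3 hrest m21
      (fun l hnd hls hrl hl₁ hl₂ hl₃ => hnt l hnd hls hrl hl₁ hl₂ hl₃)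
  by_cases m31 : (L₃ ∩ L₁).card = 1
  · exact sum_cap_le_twenty_three_of_three_big_meet h1 h2 h3 h4 h5 hL₁ hL₃ hL₂ h13 h12 h23.symm c1 c3 c2
      (fun L hL hA hB hC => hrest L hL hA hC hB) m31
      (fun l hnd hls hrl hl₁ hl₃ hl₂ => hnt l hnd hls hrl hl₁ hl₂ hl₃)
  by_cases m32 : (L₃ ∩ L₂).card = 1
  · exact sum_cap_le_twenty_three_of_three_big_meet h1 h2 h3 h4 h5 hL₂ hL₃ hL₁ h23 h12.symm h13.symm c2 c3 c1
      (fun L hL hA hB hC => hrest L hL hC hA hB) m32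
      (fun l hnd hls hrl hl₂ hl₃ hl₁ => hnt l hnd hls hrl hl₁ hl₂ hl₃)
  exact sum_cap_le_twenty_three_of_three_disjoint h1 h2 h3 h4 h5 hL₁ hL₂ hL₃ h12 h13 h23 c1 c2 c3 hrest
    (by omega) (by omega) (by omega)

include h1 h2 h3 h4 h5 h6 in
/-- **Every configuration of the spec at nullity `8` has cap sum `≤ 23`**, by the number of lines of `≥ 4`
points. -/
theorem sum_cap_le_twenty_three : ∑ L ∈ ls, capPaper L.card (fat w L) ≤ 23 := by
  set F := ls.filter (fun L => 4 ≤ L.card) with hF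
  have hFmem : ∀ L ∈ F, L ∈ ls ∧ 4 ≤ L.card := fun L hL => Finset.mem_filter.1 hL
  have hcard3 : ∀ L ∈ ls, L ∉ F → L.card = 3 := by
    intro L hL hLF
    have := (h2 L hL).1
    by_contra hne
    exact hLF (Finset.mem_filter.2 ⟨hL, by omega⟩)
  rcases (by omega : F.card = 0 ∨ F.card = 1 ∨ F.card = 2 ∨ F.card = 3 ∨ 3 < F.card)
    with h0 | hone | htwo | hthree | hfour
  · -- no big line
    refine sum_cap_le_twenty_three_of_no_big h1 h2 h3 h4 h5 (fun L hL => hcard3 L hL ?_)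
    rw [Finset.card_eq_zero.1 h0]
    exact Finset.notMem_empty L
  · -- one big line
    obtain ⟨A, hA'⟩ := Finset.card_eq_one.1 hone
    have hAF : A ∈ F := hA' ▸ Finset.mem_singleton_self A
    exact sum_cap_le_twenty_three_of_one_big h1 h2 h3 h4 h5 (hFmem A hAF).1 (hFmem A hAF).2
      (fun L hL hne => hcard3 L hL (by rw [hA']; exact fun h => hne (Finset.mem_singleton.1 h)))
  · -- two big lines
    obtain ⟨A, B, hne, hF2⟩ := Finset.card_eq_two.1 htwo
    have hAF : A ∈ F := hF2 ▸ Finset.mem_insert_self A {B}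
    have hBF : B ∈ F := hF2 ▸ Finset.mem_insert_of_mem (Finset.mem_singleton_self B)
    obtain ⟨hA', cA⟩ := hFmem A hAF
    obtain ⟨hB', cB⟩ := hFmem B hBF
    have hrest : ∀ L ∈ ls, L ≠ A → L ≠ B → L.card = 3 := fun L hL hLA hLB => hcard3 L hL (by
      rw [hF2]
      simp [hLA, hLB])
    by_cases hcop : ∃ l : List (Finset β), l.Nodup ∧ (∀ L ∈ l, L ∈ ls) ∧ lineRank l ≤ 3 ∧ A ∈ l ∧ B ∈ l
    · obtain ⟨l, hnd, hls, hr, hAl, hBl⟩ := hcop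
      exact sum_cap_le_twenty_three_of_two_big_plane h1 h2 h3 h4 h5 hA' hB' hne.symm cA cB hrest hnd hls hr
        hAl hBl
    · exact (sum_cap_le_eighteen_of_two_big_noncoplanar h1 h2 h3 h4 hA' hB' hne.symm cA cB hrest hcop).trans
        (by norm_num)
  · -- three big lines
    obtain ⟨L₁, L₂, L₃, h12, h13, h23, hF3⟩ := Finset.card_eq_three.1 hthree
    have hL₁F : L₁ ∈ F := hF3 ▸ Finset.mem_insert_self L₁ {L₂, L₃}
    have hL₂F : L₂ ∈ F := hF3 ▸ Finset.mem_insert_of_mem (Finset.mem_insert_self L₂ {L₃})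
    have hL₃F : L₃ ∈ F := hF3 ▸ Finset.mem_insert_of_mem (Finset.mem_insert_of_mem (Finset.mem_singleton_self L₃))
    have hrest : ∀ L ∈ ls, L ≠ L₁ → L ≠ L₂ → L ≠ L₃ → L.card = 3 := fun L hL hL1 hL2 hL3 => hcard3 L hL (by
      rw [hF3]
      simp [hL1, hL2, hL3])
    by_cases hr : lineRank [L₃, L₂, L₁] ≤ 3
    · exact (sum_cap_le_twenty_two_of_three_big_plane h1 h2 h3 h4 h5 (hFmem L₁ hL₁F).1 (hFmem L₂ hL₂F).1
        (hFmem L₃ hL₃F).1 h12.symm h13.symm h23.symm (hFmem L₁ hL₁F).2 (hFmem L₂ hL₂F).2 (hFmem L₃ hL₃F).2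
        hrest hr).trans (by norm_num)
    · exact sum_cap_le_twenty_three_of_three_big_nonplanar h1 h2 h3 h4 h5 (hFmem L₁ hL₁F).1 (hFmem L₂ hL₂F).1
        (hFmem L₃ hL₃F).1 h12.symm h13.symm h23.symm (hFmem L₁ hL₁F).2 (hFmem L₂ hL₂F).2 (hFmem L₃ hL₃F).2 hrest
        (by omega)
  · -- four or more big lines
    obtain ⟨L₁, hL₁, L₂, hL₂, L₃, hL₃, h12, h13, h23⟩ := Finset.two_lt_card.1 (by omega : 2 < F.card)
    obtain ⟨L₄, hL₄, hL₄'⟩ : ∃ L₄ ∈ F, L₄ ∉ ({L₁, L₂, L₃} : Finset (Finset β)) := by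
      by_contra hc
      have hsub : F ⊆ {L₁, L₂, L₃} := fun L hL => by
        by_contra h
        exact hc ⟨L, hL, h⟩
      have := Finset.card_le_card hsub
      rw [Finset.card_insert_of_notMem (by simp [h12, h13]), Finset.card_pair h23] at this
      omega
    simp only [Finset.mem_insert, Finset.mem_singleton, not_or] at hL₄'
    exact four_big_bound_sharp β w ls h1 h2 h3 h4 h5 h6 L₁ L₂ L₃ L₄ (hFmem L₁ hL₁).1 (hFmem L₂ hL₂).1
      (hFmem L₃ hL₃).1 (hFmem L₄ hL₄).1 h12.symm h13.symm hL₄'.1 h23.symm hL₄'.2.1 hL₄'.2.2 (hFmem L₁ hL₁).2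
      (hFmem L₂ hL₂).2 (hFmem L₃ hL₃).2 (hFmem L₄ hL₄).2

end Exact

/-- **THE EXACT INSTANCE `ν = 8` OF THE 4-CIRCUIT-CAP SPEC**: `FourCapSpec capPaper 8 23` — the value
`Q*(8) = 23` of the two searches is a kernel theorem. -/
theorem fourCapSpec_eight_exact : FourCapSpec capPaper 8 23 := by
  intro β _ w ls h1 h2 h3 h4 h5 h6
  exact sum_cap_le_twenty_three h1 h2 h3 h4 h5 h6

end Eight

end FourCap

end S1

end PercRepro
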